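import Summits.QuantumFields.BalabanUV.Beta.GAN24.WSlotFirstDiff
import Summits.QuantumFields.BalabanUV.Beta.GAN24.KernelLegCharges
import Summits.QuantumFields.BalabanUV.Beta.GAN24.BiTableParityHalves

/-!
# `BalabanUV.Beta.GAN24.ZeroModeParity` — binder row G-an2-4 ∕ (CONV-C), W-slot EXIT (α) (the OWNER's INTENT I-gan24p1-g33-3, piece (α-END-b):
# the `zmode` HALF of `hZ^{ev}`): THE ZERO-MODE CHARGE OF THE PARITY IMAGE `P T := sgnK ∘ trK ∘ T` IS THE CHARGE OF `T` WITH THE FIBRE INDICES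
# SWAPPED (and the fibre signs), so the bond-antisymmetric `ZfreeSym` row passes from a `LocStencil₂` table to its parity image and to its
# `ε`-halves `c • (T + ε • P T)` (row owner `b2b-balaban-gan24-p1`, gen 33)

NOT IN PRINT; OUR BOOKKEEPING ([folklore]; 0 `def`, 0 cited facts, 0 `def … : Prop`, 0 sorry).  HONEST FRAMING (cell contract, verbatim): «discharging
`BetaPertH` makes Bałaban's UV stability UNCONDITIONAL — a real constructive-QFT result; it is NOT the continuum limit and NOT the Clay problem.»  HONEST
DEPENDENCY (verbatim): «continuum YM on T⁴ ⇐ BetaPertH ∧ nine spine estimates (0/9 proved); BetaPertH ⇐ (D1) ∧ (D4) ∧ CAP+tail; G-an2-4 gates asym, D1 and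
NE2/3/4.»

WHAT (`zmode N T κ κ′ a b = Σ_{r ∈ box} Σ′_{u′} Σ′_x Σ′_z T κ r κ′ u′ x z a b`, leaf-02's `BiStencilZeroMode`; the one analytic step is the exchange of the two kernel
sums `Σ′_x Σ′_z`, legitimate on a `LocStencil₂` table at a positive rate by leaf-10's `KernelLegCharges.summable_prod_of_biLoc` ⨾ `Summable.tsum_comm`):
* §1 **`zmode_sgnK_trK`** — `zmode N (P T) κ κ′ a b = sgnF a · sgnF b · zmode N T κ κ′ b a`; `zmode_sgnK_trK_inl_inl` — on the ff block the signs are `1`.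
* §2 **`zsym_sgnK_trK`** — the `ZfreeSym` antisymmetry row (`∀ κ κ′ κ₁ κ₂, zmode N T κ κ′ (inl κ₁) (inl κ₂) + zmode N T κ′ κ (inl κ₁) (inl κ₂) = 0`, the `hZ` currency of
  p2's `T2HybridShapeEnd.shape_three_of_hyb_rows`) passes to `P T`; `zsym_add` — and to sums of `LocStencil₂` tables (leaf-18's `zmode_add`); **`zsym_halfTable`** — and
  to the `ε`-half `c • (T + ε • P T)` in the table-level spelling of the OWNER's `T2ShapeEvenEnd` (any `c ε`).
WHAT IT IS FOR: the (C)^{ε} ⟸ (C) bridge of the OWNER's `T2ShapeEvenEndRows` row `hC` (the relative source of the `ε`-member is `½ • (b′ + ε • P b′)` for the full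
member's relative source `b′` once leaf-01's two `lin4` commutations are applied — NOT here).  Asserts NO value of any charge; discharges NOTHING of (C) ∕
«T2Shape» ∕ «T2Drift» ∕ (hW, hWall) ∕ (Q-L); NEVER «G-an2-4 closed» as (CONV-C); NOT D1, NOT `BetaPertH`, NOT continuum, NOT Clay.  2026-08-23.
-/

noncomputable section

open Finset
open scoped BigOperators
open Literature.MathematicalPhysics.QuantumFieldTheory
open Literature.MathematicalPhysics.QuantumFieldTheory.Balaban1983to89
open Literature.MathematicalPhysics.QuantumFieldTheory.Balaban1983to89.Beta
open ExpKernelCalculus (MKer BiLoc)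
open OneStepResolventKernel (Fib)
open AffineAveraging (box toSite)
open BalabanCompositeJets (LocStencil₂)
open BalabanStepW2 (locStencil₂_smul' locStencil₂_add')
open Summit.QuantumFields.BalabanUV.Beta.TameKernelCalculus (trK)
open Summit.QuantumFields.BalabanUV.Beta.BorderedHessian (sgnF sgnK)
open Summit.QuantumFields.BalabanUV.Beta.GAN24.BiStencilZeroMode (zmode)
open Summit.QuantumFields.BalabanUV.Beta.GAN24.WSlotFirstDiff (zmode_add zmode_smul)
open Summit.QuantumFields.BalabanUV.Beta.GAN24.KernelLegCharges (summable_prod_of_biLoc)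
open Summit.QuantumFields.BalabanUV.Beta.GAN24.BiTableParityHalves (sgnK_trK_apply locStencil₂_sgnK_trK)

namespace Summit.QuantumFields.BalabanUV.Beta.GAN24.ZeroModeParity

variable {d : ℕ} {N : ℕ} {T A B : Fin (d + 1) → (Fin (d + 1) → ℤ) → Fin (d + 1) → (Fin (d + 1) → ℤ) → MKer (d + 1) (Fib d)} {C CA CB δ : ℝ}

/-! ## §1 The zero-mode charge of the parity image -/

/-- [folklore] **`zmode N (P T) κ κ′ a b = sgnF a · sgnF b · zmode N T κ κ′ b a`** for a `LocStencil₂` table at a positive rate (the two kernel sums are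
exchanged by `Summable.tsum_comm` on leaf-10's `summable_prod_of_biLoc`). -/
theorem zmode_sgnK_trK (hT : LocStencil₂ T C δ) (hδ : 0 < δ) (κ κ' : Fin (d + 1)) (a b : Fib d) :
    zmode N (fun κ u κ' u' => sgnK (trK (T κ u κ' u'))) κ κ' a b = sgnF a * sgnF b * zmode N T κ κ' b a := by
  simp only [zmode, sgnK_trK_apply, tsum_mul_left, Finset.mul_sum]
  refine Finset.sum_congr rfl fun r _ => ?_
  congr 1
  refine tsum_congr fun u' => ?_
  exact (summable_prod_of_biLoc (hT κ (toSite r) κ' u') hδ b a).tsum_comm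

/-- [folklore] On the ff block the fibre signs are `1`: `zmode N (P T) κ κ′ (inl κ₁) (inl κ₂) = zmode N T κ κ′ (inl κ₂) (inl κ₁)`. -/
theorem zmode_sgnK_trK_inl_inl (hT : LocStencil₂ T C δ) (hδ : 0 < δ) (κ κ' κ₁ κ₂ : Fin (d + 1)) :
    zmode N (fun κ u κ' u' => sgnK (trK (T κ u κ' u'))) κ κ' (Sum.inl κ₁) (Sum.inl κ₂) = zmode N T κ κ' (Sum.inl κ₂) (Sum.inl κ₁) := by
  rw [zmode_sgnK_trK hT hδ, BorderedHessian.sgnF_inl, BorderedHessian.sgnF_inl, one_mul, one_mul]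

/-! ## §2 The `ZfreeSym` antisymmetry row passes to the parity image, to sums, and to the `ε`-halves -/

/-- [folklore] **`ZfreeSym` PASSES TO THE PARITY IMAGE** (the row is symmetric under the swap of the two ff fibre indices it quantifies over). -/
theorem zsym_sgnK_trK (hT : LocStencil₂ T C δ) (hδ : 0 < δ)
    (hZ : ∀ κ κ' κ₁ κ₂, zmode N T κ κ' (Sum.inl κ₁) (Sum.inl κ₂) + zmode N T κ' κ (Sum.inl κ₁) (Sum.inl κ₂) = 0) (κ κ' κ₁ κ₂ : Fin (d + 1)) :
    zmode N (fun κ u κ' u' => sgnK (trK (T κ u κ' u'))) κ κ' (Sum.inl κ₁) (Sum.inl κ₂) +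
      zmode N (fun κ u κ' u' => sgnK (trK (T κ u κ' u'))) κ' κ (Sum.inl κ₁) (Sum.inl κ₂) = 0 := by
  rw [zmode_sgnK_trK_inl_inl hT hδ, zmode_sgnK_trK_inl_inl hT hδ]
  exact hZ κ κ' κ₂ κ₁

/-- [folklore] **`ZfreeSym` IS ADDITIVE ON `LocStencil₂` TABLES** (leaf-18's `zmode_add`). -/
theorem zsym_add (hA : LocStencil₂ A CA δ) (hB : LocStencil₂ B CB δ) (hδ : 0 < δ)
    (hZA : ∀ κ κ' κ₁ κ₂, zmode N A κ κ' (Sum.inl κ₁) (Sum.inl κ₂) + zmode N A κ' κ (Sum.inl κ₁) (Sum.inl κ₂) = 0)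
    (hZB : ∀ κ κ' κ₁ κ₂, zmode N B κ κ' (Sum.inl κ₁) (Sum.inl κ₂) + zmode N B κ' κ (Sum.inl κ₁) (Sum.inl κ₂) = 0) (κ κ' κ₁ κ₂ : Fin (d + 1)) :
    zmode N (A + B) κ κ' (Sum.inl κ₁) (Sum.inl κ₂) + zmode N (A + B) κ' κ (Sum.inl κ₁) (Sum.inl κ₂) = 0 := by
  have e : (A + B) = fun κ u κ' u' => A κ u κ' u' + B κ u κ' u' := rfl
  rw [e, zmode_add hA hB hδ, zmode_add hA hB hδ]
  have h1 := hZA κ κ' κ₁ κ₂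
  have h2 := hZB κ κ' κ₁ κ₂
  linarith

/-- [folklore] **`ZfreeSym` PASSES TO THE `ε`-HALF `c • (T + ε • P T)`** (table-level spelling of the OWNER's `T2ShapeEvenEnd`; any `c ε`; `LocStencil₂` at a
positive rate for the exchange of sums). -/
theorem zsym_halfTable (hT : LocStencil₂ T C δ) (hδ : 0 < δ)
    (hZ : ∀ κ κ' κ₁ κ₂, zmode N T κ κ' (Sum.inl κ₁) (Sum.inl κ₂) + zmode N T κ' κ (Sum.inl κ₁) (Sum.inl κ₂) = 0) (c ε : ℝ) (κ κ' κ₁ κ₂ : Fin (d + 1)) :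
    zmode N (c • (T + ε • fun κ u κ' u' => sgnK (trK (T κ u κ' u')))) κ κ' (Sum.inl κ₁) (Sum.inl κ₂) +
      zmode N (c • (T + ε • fun κ u κ' u' => sgnK (trK (T κ u κ' u')))) κ' κ (Sum.inl κ₁) (Sum.inl κ₂) = 0 := by
  have hP : LocStencil₂ (fun κ u κ' u' => ε • sgnK (trK (T κ u κ' u'))) (|ε| * C) δ := locStencil₂_smul' ε (locStencil₂_sgnK_trK hT)
  have e : (c • (T + ε • fun κ u κ' u' => sgnK (trK (T κ u κ' u')))) =
      fun κ u κ' u' => c • (T κ u κ' u' + ε • sgnK (trK (T κ u κ' u'))) := rfl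
  have eP : ∀ κ κ' κ₁ κ₂, zmode N (fun κ u κ' u' => ε • sgnK (trK (T κ u κ' u'))) κ κ' (Sum.inl κ₁) (Sum.inl κ₂) =
      ε * zmode N (fun κ u κ' u' => sgnK (trK (T κ u κ' u'))) κ κ' (Sum.inl κ₁) (Sum.inl κ₂) := fun κ κ' κ₁ κ₂ => zmode_smul ε _ κ κ' _ _
  rw [e, zmode_smul, zmode_smul, zmode_add hT hP hδ, zmode_add hT hP hδ, eP, eP]
  have h1 := hZ κ κ' κ₁ κ₂
  have h2 := zsym_sgnK_trK (N := N) hT hδ hZ κ κ' κ₁ κ₂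
  have : c * (zmode N T κ κ' (Sum.inl κ₁) (Sum.inl κ₂) + ε * zmode N (fun κ u κ' u' => sgnK (trK (T κ u κ' u'))) κ κ' (Sum.inl κ₁) (Sum.inl κ₂)) +
      c * (zmode N T κ' κ (Sum.inl κ₁) (Sum.inl κ₂) + ε * zmode N (fun κ u κ' u' => sgnK (trK (T κ u κ' u'))) κ' κ (Sum.inl κ₁) (Sum.inl κ₂)) =
      c * (zmode N T κ κ' (Sum.inl κ₁) (Sum.inl κ₂) + zmode N T κ' κ (Sum.inl κ₁) (Sum.inl κ₂)) +
      c * ε * (zmode N (fun κ u κ' u' => sgnK (trK (T κ u κ' u'))) κ κ' (Sum.inl κ₁) (Sum.inl κ₂) +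
        zmode N (fun κ u κ' u' => sgnK (trK (T κ u κ' u'))) κ' κ (Sum.inl κ₁) (Sum.inl κ₂)) := by ring
  rw [this, h1, h2, mul_zero, mul_zero, add_zero]

end Summit.QuantumFields.BalabanUV.Beta.GAN24.ZeroModeParity

end
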